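import Mathlib
import HarnessLib
import Literature.Analysis.FluidPDE.SelfSimilar
import Literature.Analysis.FluidPDE.ClassicalSolution
import Literature.Analysis.FluidPDE.CurlFreeLiouville
import Literature.Analysis.FluidPDE.OseenMildUniqueness
import Literature.Analysis.FluidPDE.KNSSRemark61
import Literature.Analysis.FluidPDE.TaoEnstrophyLocalisation
import Summits.NavierStokesRegularity.NavierStokesRegularity.Theorems.UnthreadedDoorNetFluxDefs
import Summits.NavierStokesRegularity.NavierStokesRegularity.Theorems.TypeILiouvilleTypeIliouvilleLOseenGauge

/-!
# Route `UnthreadedDoor`, crux `PoloidalLiouville` (stmt-NavierStokesRegularity-1222), WALL W1 — cell-flux Z skeleton, stub Z-2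
# `ForwardVanishing` PROVED (`Cruxes/PoloidalLiouville/CellFluxZSkeleton.lean` v1.1 c6ae0be7f8d8, custodian ns-idea-14 g6; critic ns-wall-crit-1 V22)

`forwardVanishing` — binders VERBATIM the skeleton's `ZSkeleton.ForwardVanishing` (= the Theorems-side twin `CellFlux.ForwardVanishing`):
a bounded ancient mild solution (`ν = 1`, the tree's duality class) with a.e.-strongly measurable slices, jointly smooth on `(-∞,0) × ℝ³`,
whose vorticity vanishes identically at one time `a < 0` is irrotational at every later time `t ∈ [a, 0)`.

PROOF (the skeleton's recipe, all inputs landed).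
* Oseen gauge (`Theorems.oseen_gauge_of_aestronglyMeasurable`, crux `TypeIliouvilleL`): `v t = w t (· − A t) + c t` a.e. for every `t < 0`, with
  `w` continuous and uniformly bounded on the slab, weakly divergence free, pointwise Oseen-mild between any two negative times; both sides are
  continuous in `x` (the slice `v t` by the smoothness hypothesis), so the representation holds EVERYWHERE (`galilean_rep_everywhere`).
* At time `a`: `w a = v a (· + A a) − c a` is smooth, bounded, weakly (hence classically) divergence free and curl free, so it is a constant `b`
  (KNSS 2009 Lemma 3.1; tree `eq_of_curl_eq_zero_of_isDivFree_of_bounded`).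
* Forward uniqueness of bounded Oseen-mild solutions against the constant solution `b` (`heatExtension_const`, `oseenDuhamel_eq_zero_of_const`,
  `oseenMild_bounded_unique`; the pattern of `ClockCeiling….eq_const_after_of_slice_const`): `w t ≡ b` for `a < t < 0` (`oseen_const_forward`),
  hence `v t ≡ b + c t` is constant and `curl (v t) ≡ 0`.

WHAT THIS IS NOT: one of four stubs of Z (`ZonalUnthreadedVorticityVanishes`), itself information-grade for W1 (critic V22-P6 (a));
`PoloidalLiouville` (1222), Z, W1 and NS regularity stay OPEN.  `--supports stmt-NavierStokesRegularity-1222 --as helper`.  [folklore]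
-/

noncomputable section

-- the summit and its single sub-problem share the name (CONVENTIONS §1)
set_option linter.dupNamespace false

open Set Function Filter Topology MeasureTheory Metric
open scoped ENNReal

namespace Summit.NavierStokesRegularity.NavierStokesRegularity.Theorems.PoloidalLiouville.CellFlux

open Summit.NavierStokesRegularity.NavierStokesRegularity.Theorems.PoloidalLiouville.NetFlux (E3)
open Literature.Analysis Literature.Analysis.FluidPDE

/-! ### Curl bookkeeping under Galilean changes of frame -/

/-- `curl (g(· + a) − c)(x) = (curl g)(x + a)` (no differentiability hypothesis: junk values transform alike). [folklore] -/
theorem curl_comp_add_sub_const (g : E3 → E3) (a c x : E3) :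
    curl (fun y => g (y + a) - c) x = curl g (x + a) := by
  rw [curl_eq_curlCLM, curl_eq_curlCLM, fderiv_sub_const, fderiv_comp_add_right]

/-! ### The Galilean representation holds everywhere for smooth members of the class -/

/-- Slices of a field continuous on the open past slab are continuous. [folklore] -/
theorem continuous_slice_of_continuousOn {w : ℝ → E3 → E3} (hwc : ContinuousOn (uncurry w) (Iio (0 : ℝ) ×ˢ univ))
    {t : ℝ} (ht : t < 0) : Continuous (w t) :=
  hwc.comp_continuous (Continuous.prodMk_right t) fun _ => ⟨ht, mem_univ _⟩

/-- **Everywhere form of the Oseen gauge representation.**  If `v` is continuous on the slab (slice-wise suffices) and `w` is continuous on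
the slab, an a.e. identity `v t = w t (· − A t) + c t` holds pointwise. [folklore] -/
theorem galilean_rep_everywhere {v w : ℝ → E3 → E3} {A c : ℝ → E3}
    (hvc : ContinuousOn (uncurry v) (Iio (0 : ℝ) ×ˢ univ)) (hwc : ContinuousOn (uncurry w) (Iio (0 : ℝ) ×ˢ univ))
    (hrep : ∀ t < 0, v t =ᵐ[volume] fun x => w t (x - A t) + c t) {t : ℝ} (ht : t < 0) (x : E3) :
    v t x = w t (x - A t) + c t := by
  have hvt : Continuous (v t) := continuous_slice_of_continuousOn hvc ht
  have hrhs : Continuous fun x : E3 => w t (x - A t) + c t :=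
    ((continuous_slice_of_continuousOn hwc ht).comp (continuous_id.sub continuous_const)).add continuous_const
  exact congr_fun ((Continuous.ae_eq_iff_eq volume hvt hrhs).1 (hrep t ht)) x

/-! ### Forward uniqueness from a constant slice in the bounded Oseen class -/

/-- **A bounded continuous Oseen-mild field with one CONSTANT slice is constant afterwards**: if `w(a, ·) ≡ b` then `w(t, ·) ≡ b` for all
`a < t < 0` — on the slab `(a, t/2)` both `w` and the constant field `b` are bounded jointly measurable solutions of the Oseen integral equation
with the same free term `e^{(τ−a)Δ}w(a) = b` (`heatExtension_const`, `oseenDuhamel_eq_zero_of_const`), so they agree a.e.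
(`oseenMild_bounded_unique`, KNSS 2009 §4 (4.3)–(4.4)), hence everywhere by continuity of the slice. [folklore] -/
theorem oseen_const_forward {w : ℝ → E3 → E3} (hwc : ContinuousOn (uncurry w) (Iio (0 : ℝ) ×ˢ univ))
    {K : ℝ} (hK : ∀ t < 0, ∀ x, ‖w t x‖ ≤ K)
    (hmild : ∀ s t : ℝ, s < t → t < 0 → ∀ x,
      w t x = UnboundedOperators.heatExtension (w s) (t - s) x - oseenDuhamel 1 s w w t x)
    {a : ℝ} {b : E3} (hb : ∀ y, w a y = b) {t : ℝ} (hat : a < t) (ht : t < 0) (y : E3) :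
    w t y = b := by
  -- the slab `(a, T')`, `T' = t / 2`
  have hT'0 : t / 2 < 0 := by linarith
  have htI : t ∈ Ioo a (t / 2) := ⟨hat, by linarith⟩
  set M : ℝ := max K ‖b‖ with hMdef
  have hM : 0 ≤ M := le_max_of_le_right (norm_nonneg _)
  have huM : ∀ τ ∈ Ioo a (t / 2), ∀ z, ‖w τ z‖ ≤ M := fun τ hτ z =>
    (hK τ (hτ.2.trans hT'0) z).trans (le_max_left _ _)
  set V : ℝ → E3 → E3 := fun _ _ => b with hVdef
  have hvM : ∀ τ ∈ Ioo a (t / 2), ∀ z : E3, ‖V τ z‖ ≤ M := fun τ _ z => le_max_right _ _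
  have hsub : Ioo a (t / 2) ×ˢ (univ : Set E3) ⊆ Iio 0 ×ˢ univ :=
    prod_mono (fun τ hτ => hτ.2.trans hT'0) Subset.rfl
  have hum : AEStronglyMeasurable (uncurry w)
      ((volume : Measure (ℝ × E3)).restrict (Ioo a (t / 2) ×ˢ univ)) :=
    (hwc.mono hsub).aestronglyMeasurable (measurableSet_Ioo.prod MeasurableSet.univ)
  have hvm : AEStronglyMeasurable (uncurry V)
      ((volume : Measure (ℝ × E3)).restrict (Ioo a (t / 2) ×ˢ univ)) :=
    aestronglyMeasurable_const
  have hWa : w a = fun _ => b := funext hb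
  -- the two integral equations with the common free term `e^{(τ-a)Δ} w(a) = b`
  have hu : ∀ τ ∈ Ioo a (t / 2), w τ =ᵐ[volume] fun z =>
      UnboundedOperators.heatExtension (w a) (τ - a) z - oseenDuhamel 1 a w w τ z :=
    fun τ hτ => Eventually.of_forall fun z => hmild a τ hτ.1 (hτ.2.trans hT'0) z
  have hv : ∀ τ ∈ Ioo a (t / 2), V τ =ᵐ[volume] fun z =>
      UnboundedOperators.heatExtension (w a) (τ - a) z - oseenDuhamel 1 a V V τ z := by
    intro τ hτ
    refine Eventually.of_forall fun z => ?_
    have hD : oseenDuhamel 1 a V V τ z = 0 :=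
      oseenDuhamel_eq_zero_of_const (b := fun _ => b) (c := fun _ => b)
        (fun _ _ _ => rfl) (fun _ _ _ => rfl) z
    show V τ z = UnboundedOperators.heatExtension (w a) (τ - a) z - oseenDuhamel 1 a V V τ z
    rw [hD, sub_zero, hWa, UnboundedOperators.heatExtension_const _ (sub_pos.2 hτ.1)]
  have key := oseenMild_bounded_unique one_pos hM hum hvm huM hvM hu hv t htI
  have heq := (Continuous.ae_eq_iff_eq volume (continuous_slice_of_continuousOn hwc ht) continuous_const).1 key
  exact congr_fun heq y

/-! ### Z-2 -/

/-- **Z-2 `ForwardVanishing` (cell-flux Z skeleton v1.1, binders VERBATIM).**  A bounded ancient mild solution (`ν = 1`) with a.e.-strongly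
measurable slices, jointly smooth on `(-∞,0) × ℝ³`, whose vorticity vanishes identically at a time `a < 0`, is irrotational at every `t ∈ [a,0)`:
Oseen gauge everywhere ⇒ `w a` is a bounded smooth curl- and divergence-free field, hence a constant `b` (KNSS Lemma 3.1) ⇒ `w t ≡ b` for
`a < t < 0` by forward uniqueness of bounded Oseen-mild solutions ⇒ `v t ≡ b + c t`. [folklore] -/
theorem forwardVanishing :
    ∀ (v : ℝ → E3 → E3),
    IsBoundedAncientMildSolution 1 v → (∀ t < 0, AEStronglyMeasurable (v t) volume) →
    ContDiffOn ℝ (⊤ : ℕ∞) (uncurry v) (Iio 0 ×ˢ univ) →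
    ∀ a < 0, (∀ x, curl (v a) x = 0) → ∀ t, a ≤ t → t < 0 → ∀ x, curl (v t) x = 0 := by
  intro v hB hmeas hsmooth a ha hcurl t hat ht x
  rcases hat.eq_or_lt with rfl | hat'
  · exact hcurl x
  -- the Oseen gauge, everywhere
  obtain ⟨w, A, c, -, hwc, ⟨K, hK⟩, hwdiv, hwmild, -, hrep⟩ :=
    Theorems.oseen_gauge_of_aestronglyMeasurable v hB hmeas
  have hrep' : ∀ s < 0, ∀ y, v s y = w s (y - A s) + c s :=
    fun s hs y => galilean_rep_everywhere hsmooth.continuousOn hwc hrep hs y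
  -- the representative slice at time `a` is a translate of `v a` minus a constant
  have hwa : w a = fun y => v a (y + A a) - c a := by
    funext y
    have h := hrep' a ha (y + A a)
    rw [add_sub_cancel_right] at h
    rw [h, add_sub_cancel_right]
  -- it is smooth, bounded, divergence free and curl free, hence constant
  have hsm : IsSmoothSpaceTimeOn (Iio 0) v := hsmooth
  have hva : ContDiff ℝ (⊤ : ℕ∞) (v a) := hsm.contDiff_slice ha
  have hwa_smooth : ContDiff ℝ (⊤ : ℕ∞) (w a) := by
    rw [hwa]
    exact (hva.comp (contDiff_id.add contDiff_const)).sub contDiff_const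
  have hwa2 : ContDiff ℝ 2 (w a) := hwa_smooth.of_le (by norm_cast)
  have hwa1 : ContDiff ℝ 1 (w a) := hwa_smooth.of_le (by norm_cast)
  have hwa_div : VectorCalculus.IsDivFree (w a) := (hwdiv a ha).isDivFree_of_contDiff hwa1
  have hwa_curl : ∀ y, curl (w a) y = 0 := fun y => by
    rw [hwa, curl_comp_add_sub_const]
    exact hcurl (y + A a)
  have hb : ∀ y, w a y = w a 0 := fun y =>
    eq_of_curl_eq_zero_of_isDivFree_of_bounded hwa2 hwa_curl hwa_div (fun z => hK a ha z) y 0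
  -- forward uniqueness: `w t ≡ w a 0`, so `v t` is constant
  have hwt : ∀ y, w t y = w a 0 := fun y => oseen_const_forward hwc hK hwmild hb hat' ht y
  have hvt : v t = fun _ => w a 0 + c t := by
    funext y
    rw [hrep' t ht y, hwt]
  rw [hvt]
  exact curl_eq_zero_of_fderiv_eq_zero (by simp)

end Summit.NavierStokesRegularity.NavierStokesRegularity.Theorems.PoloidalLiouville.CellFlux

end
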